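import Summits.CriticalPhenomena.PercolationContinuityZ3.Theorems.Transplant.SkelNeg1ParamsKit
import Summits.CriticalPhenomena.PercolationContinuityZ3.Theorems.Transplant.SkelNeg1ParamsP
import Summits.CriticalPhenomena.PercolationContinuityZ3.Theorems.Transplant.PlanarSkeletonFrmDefs
import Summits.CriticalPhenomena.PercolationContinuityZ3.Theorems.Transplant.SkelPhiStepIDataNS
import Summits.CriticalPhenomena.PercolationContinuityZ3.Theorems.Transplant.SkelNegParamsLattice
import Summits.CriticalPhenomena.PercolationContinuityZ3.Theorems.Transplant.SkelPhiStepINegDefs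
import Summits.CriticalPhenomena.PercolationContinuityZ3.Theorems.Transplant.SkelNeg1ParamsO
import HarnessLib

/-!
# N2 (frames-only node `SamePDropOfSkeletonFrm₁`, OPEN) params column over `PlanarSkeletonFrm` — (ζ″) ledger, shape (B′) of record ((R-14)):
# MECHANICAL PORT of N1's `SkelNeg1ParamsP` — part 2 (p-level values, skeleton-level): THE CONSTANTS OF THE {±1} NODE'S CHOICE FUNCTION THAT ARE FIXED BEFORE STEP I″ —
# `PlanarSkeletonNeg.Neg.K/Kq/cells/C'/cmax/δkit/δI/η` as functions of the handed constants `κ : SkelConc.Consts` and the skeleton `Φ : PlanarSkeletonNeg G` (twin of … (N1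
# title abridged; see `SkelNeg1ParamsP`)
builds on p205010 (kernel theorem, internal audit signed; external expert review pending) — nothing in this file uses p205010; NOTHING is claimed about the
open node `SamePDropOfSkeletonFrm₁` (`SamePDropOfSkeletonNeg₁` is CLOSED in the tree and untouched by this file).
Status sentence (coordinator 2026-08-20T04:30Z): "θ(p_c) = 0 on ℤ^d, all d ≥ 2 — kernel-verified (Lean 4/Mathlib, standard axioms); internal adversarial
audit SIGNED 2026-08-20 04:29Z; external expert review pending."
Lane `prim-bschramm-*`, seat `prim-bschramm-stmt` (gen 19); helper file (`--supports stmt-CriticalPhenomena-4575 --as helper`); ledger HOME/prim-bschramm-stmt/FRM-PARAMS.md §9, (R-14).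
PORT RULES (HOME/prim-bschramm-stmt-g19/lean/port_frm.py, the tool of record per (R-14)): outer namespace `PlanarSkeletonNeg ↦ PlanarSkeletonFrm`, carrier binder
`(Φ : PlanarSkeletonFrm G)`, record binder `(D : Skelφ.StepI.DataNS V)` (the selectors travel IN the record, `SkelPhiStepIDataNS`); section variables INLINED into every
declaration header; inner namespaces (`Neg`/`NegB`/`KS`/…) and every short name KEPT so all cross-references resolve unchanged; declarations using no section variable are
NOT re-declared (N1's originals are referenced fully qualified). Mathematical content, proofs, docstrings and citations are N1's, verbatim, except where stated next.
SELECTORS IN THIS FILE ((R-14) condition of record — joint selection, `D.sN`'s first argument is the literal handed to `D.sM`): none in part P (cells/accuracies); part O (below) draws the SHORT pair.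
N1 HEADER (kept for the reader):
helper file (`--supports stmt-CriticalPhenomena-4575 --as helper`); ledger HOME/prim-bschramm-stmt/NEG-PARAMS.md
v0.5 §0 (n0)–(n1), §5.  ORDER (N.3 for N1, p-level part): handed `κ = (K₀, δ, δ₂, δr)` (the closure hands `δ := δC_N(ε)` with `nmaxN = 2000`, p3's
`SkelNeg1Closure`) → `K := Kcell K₀ = 40·(Kof K₀/40 + 1)` (`κ.K₀ ≤ K`, `40 ∣ K`), one-unit cells `⟨K, 1⟩` → the instance constants `C′ := 8` (D4's depth
fraction, p3 Q7) and `c_max := 3` (cells per run, hp-8 §11 (ii)) → the accuracies `δkit := Prm.δkit G Φ.degree_le κ 0` (budget `nmax 0 = 1000`: below `κ.δ`,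
`κ.δ₂`, every `κ.δr n` and every inner-chain accuracy `δUP n (δ₂²)` for `n ≤ 1000`), `δI := δkit²/16` (Step I″ is asked for `1 − δI`), `η := δkit/2` (excess).
Everything after Step I″ (`M_u, n_s, …, negChoice₀`) waits for (L0-4) `StepI.DataN` and p3's `SkelNeg1Choice` (NEG-PARAMS §3).
[cite: KozmaNitzan2024, §4 Theorem 6 (pp. 25–31): the order of constants] [cite: MartineauTassion2017, §3.2]
-/

noncomputable section

namespace Summit.CriticalPhenomena.PercolationContinuityZ3.Theorems.Transplant

namespace Skelφ.NegPrm

/-! ## §0 Admissibility of the scale list under Step I″'s threshold FUNCTION (ledger V0 = option 1: `n₁ : ℕ → ℕ`) -/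

end Skelφ.NegPrm

namespace PlanarSkeletonFrm

namespace Neg

open Literature.Probability.Percolation Literature.Probability.LatticeModels SimpleGraph
open SkelConc (Consts)
open BoxProdZ2 (Kof)

section Handed

/-! ## §1 From the handed constants: the cell constant and the cells -/

export PlanarSkeletonNeg.Neg (K)

export PlanarSkeletonNeg.Neg (Kq)

export PlanarSkeletonNeg.Neg (cells)

export PlanarSkeletonNeg.Neg (K_eq)

export PlanarSkeletonNeg.Neg (K₀_le_K)

export PlanarSkeletonNeg.Neg (Kof_le_K)

export PlanarSkeletonNeg.Neg (forty_le_K)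

export PlanarSkeletonNeg.Neg (one_le_Kq)

export PlanarSkeletonNeg.Neg (forty_dvd_K)

export PlanarSkeletonNeg.Neg (cells_K)

export PlanarSkeletonNeg.Neg (cells_s)

export PlanarSkeletonNeg.Neg (cells_r)

export PlanarSkeletonNeg.Neg (cells_rmax)

export PlanarSkeletonNeg.Neg (K₀_le_cells_K)

/-! ## §2 The instance constants `C′` and `c_max` -/

export PlanarSkeletonNeg.Neg (C')

export PlanarSkeletonNeg.Neg (cmax)

export PlanarSkeletonNeg.Neg (C'_eq)

export PlanarSkeletonNeg.Neg (cmax_eq)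

end Handed

section Acc

/-! ## §3 The accuracies -/

/-- **The kit accuracy of N1** `δkit := Prm.δkit G Φ.degree_le κ 0` (budget `nmax 0 = 1000`). [this work] -/
def δkit (κ : Consts) {V : Type} [DecidableEq V] [Countable V] {G : SimpleGraph V} [G.LocallyFinite] (Φ : PlanarSkeletonFrm G) : ℝ := Skelφ.Prm.δkit G Φ.degree_le κ 0

/-- **The Step-I″ accuracy of N1** `δI := Prm.δI G Φ.degree_le κ 0 = δkit²/16`. [this work] -/
def δI (κ : Consts) {V : Type} [DecidableEq V] [Countable V] {G : SimpleGraph V} [G.LocallyFinite] (Φ : PlanarSkeletonFrm G) : ℝ := Skelφ.Prm.δI G Φ.degree_le κ 0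

/-- **The excess accuracy** `η := δkit/2`. [this work] -/
def η (κ : Consts) {V : Type} [DecidableEq V] [Countable V] {G : SimpleGraph V} [G.LocallyFinite] (Φ : PlanarSkeletonFrm G) : ℝ := Neg.δkit κ Φ / 2

/-- `0 < δkit`. [folklore] -/
theorem δkit_pos (κ : Consts) {V : Type} [DecidableEq V] [Countable V] {G : SimpleGraph V} [G.LocallyFinite] (Φ : PlanarSkeletonFrm G) : 0 < Neg.δkit κ Φ := Skelφ.Prm.δkit_pos G Φ.degree_le κ 0

/-- `δkit ≤ 1`. [folklore] -/
theorem δkit_le_one (κ : Consts) {V : Type} [DecidableEq V] [Countable V] {G : SimpleGraph V} [G.LocallyFinite] (Φ : PlanarSkeletonFrm G) : Neg.δkit κ Φ ≤ 1 := Skelφ.Prm.δkit_le_one G Φ.degree_le κ 0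

/-- `δkit ≤ κ.δ` (the corridor kits). [folklore] -/
theorem δkit_le_δ (κ : Consts) {V : Type} [DecidableEq V] [Countable V] {G : SimpleGraph V} [G.LocallyFinite] (Φ : PlanarSkeletonFrm G) : Neg.δkit κ Φ ≤ κ.δ := Skelφ.Prm.δkit_le_δ G Φ.degree_le κ 0

/-- `δkit ≤ κ.δ₂` (the face kits). [folklore] -/
theorem δkit_le_δ₂ (κ : Consts) {V : Type} [DecidableEq V] [Countable V] {G : SimpleGraph V} [G.LocallyFinite] (Φ : PlanarSkeletonFrm G) : Neg.δkit κ Φ ≤ κ.δ₂ := Skelφ.Prm.δkit_le_δ₂ G Φ.degree_le κ 0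

/-- `δkit ≤ κ.δr n` for every root-run length `n ≤ 1000` (`N_R + 1 ≤ 481`). [folklore] -/
theorem δkit_le_δr (κ : Consts) {V : Type} [DecidableEq V] [Countable V] {G : SimpleGraph V} [G.LocallyFinite] (Φ : PlanarSkeletonFrm G) {n : ℕ} (hn : n ≤ 1000) : Neg.δkit κ Φ ≤ κ.δr n := Skelφ.NegPrm.δkit₀_le_δr G Φ.degree_le κ hn

/-- `δkit ≤ δUP n (δ₂²)` for every inner-chain length `n ≤ 1000` (`n_F = 880`). [folklore] -/
theorem δkit_le_δUP (κ : Consts) {V : Type} [DecidableEq V] [Countable V] {G : SimpleGraph V} [G.LocallyFinite] (Φ : PlanarSkeletonFrm G) {n : ℕ} (hn : n ≤ 1000) : Neg.δkit κ Φ ≤ Skelφ.δUP G Φ.degree_le n (κ.δ₂ ^ 2) :=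
  Skelφ.NegPrm.δkit₀_le_δUP G Φ.degree_le κ hn

/-- `0 < δI`. [folklore] -/
theorem δI_pos (κ : Consts) {V : Type} [DecidableEq V] [Countable V] {G : SimpleGraph V} [G.LocallyFinite] (Φ : PlanarSkeletonFrm G) : 0 < Neg.δI κ Φ := Skelφ.Prm.δI_pos G Φ.degree_le κ 0

/-- `δI ≤ 1`. [folklore] -/
theorem δI_le_one (κ : Consts) {V : Type} [DecidableEq V] [Countable V] {G : SimpleGraph V} [G.LocallyFinite] (Φ : PlanarSkeletonFrm G) : Neg.δI κ Φ ≤ 1 := Skelφ.Prm.δI_le_one G Φ.degree_le κ 0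

/-- `δI = (δkit/4)²` and `δI ≤ δkit²`. [folklore] -/
theorem δI_eq (κ : Consts) {V : Type} [DecidableEq V] [Countable V] {G : SimpleGraph V} [G.LocallyFinite] (Φ : PlanarSkeletonFrm G) : Neg.δI κ Φ = (Neg.δkit κ Φ / 4) ^ 2 ∧ Neg.δI κ Φ ≤ Neg.δkit κ Φ ^ 2 :=
  ⟨Skelφ.Prm.δI_eq G Φ.degree_le κ 0, Skelφ.Prm.δI_le_sq G Φ.degree_le κ 0⟩

/-- `δI ≤ a²` whenever `δkit ≤ a` (the consumers' `1 − a²` thresholds from the Step-I″ inputs `> 1 − δI`). [folklore] -/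
theorem δI_le_sq_of_le (κ : Consts) {V : Type} [DecidableEq V] [Countable V] {G : SimpleGraph V} [G.LocallyFinite] (Φ : PlanarSkeletonFrm G) {a : ℝ} (ha : Neg.δkit κ Φ ≤ a) : Neg.δI κ Φ ≤ a ^ 2 := Skelφ.Prm.δI_le_sq_of_le G Φ.degree_le κ 0 ha

/-- `0 < η`, `η ≤ δkit/2`, `2η = δkit`. [folklore] -/
theorem η_pos (κ : Consts) {V : Type} [DecidableEq V] [Countable V] {G : SimpleGraph V} [G.LocallyFinite] (Φ : PlanarSkeletonFrm G) : 0 < Neg.η κ Φ ∧ Neg.η κ Φ ≤ Neg.δkit κ Φ / 2 ∧ 2 * Neg.η κ Φ = Neg.δkit κ Φ := by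
  refine ⟨?_, le_rfl, ?_⟩
  · unfold η; exact half_pos (Neg.δkit_pos κ Φ)
  · unfold η; ring

/-- **Monotonicity of the Step-I″ inputs in the threshold**: an input `> 1 − δI` is `> 1 − b` for every `b ≥ δI`. [folklore] -/
theorem inputs_mono (κ : Consts) {V : Type} [DecidableEq V] [Countable V] {G : SimpleGraph V} [G.LocallyFinite] (Φ : PlanarSkeletonFrm G) {b P : ℝ} (hb : Neg.δI κ Φ ≤ b) (h : 1 - Neg.δI κ Φ < P) : 1 - b < P := by linarith

end Acc

end Neg

end PlanarSkeletonFrm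

end Summit.CriticalPhenomena.PercolationContinuityZ3.Theorems.Transplant

end

/-!
# N2 (frames-only node `SamePDropOfSkeletonFrm₁`, OPEN) params column over `PlanarSkeletonFrm` — (ζ″) ledger, shape (B′) of record ((R-14)):
# MECHANICAL PORT of N1's `SkelNeg1ParamsO` — part 3a (O-level values, skeleton-level): THE SHORT SCALE, THE KIT, THE COUNTS AND THE LONG BOX of the {±1} node's choice
# function as functions of the Step-I″ record `D : Skelφ.StepI.DataN V` (p272964) — … (N1 title abridged; see `SkelNeg1ParamsO`)
builds on p205010 (kernel theorem, internal audit signed; external expert review pending) — nothing in this file uses p205010; NOTHING is claimed about the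
open node `SamePDropOfSkeletonFrm₁` (`SamePDropOfSkeletonNeg₁` is CLOSED in the tree and untouched by this file).
Status sentence (coordinator 2026-08-20T04:30Z): "θ(p_c) = 0 on ℤ^d, all d ≥ 2 — kernel-verified (Lean 4/Mathlib, standard axioms); internal adversarial
audit SIGNED 2026-08-20 04:29Z; external expert review pending."
Lane `prim-bschramm-*`, seat `prim-bschramm-stmt` (gen 19); helper file (`--supports stmt-CriticalPhenomena-4575 --as helper`); ledger HOME/prim-bschramm-stmt/FRM-PARAMS.md §9, (R-14).
PORT RULES (HOME/prim-bschramm-stmt-g19/lean/port_frm.py, the tool of record per (R-14)): outer namespace `PlanarSkeletonNeg ↦ PlanarSkeletonFrm`, carrier binder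
`(Φ : PlanarSkeletonFrm G)`, record binder `(D : Skelφ.StepI.DataNS V)` (the selectors travel IN the record, `SkelPhiStepIDataNS`); section variables INLINED into every
declaration header; inner namespaces (`Neg`/`NegB`/`KS`/…) and every short name KEPT so all cross-references resolve unchanged; declarations using no section variable are
NOT re-declared (N1's originals are referenced fully qualified). Mathematical content, proofs, docstrings and citations are N1's, verbatim, except where stated next.
SELECTORS IN THIS FILE ((R-14) condition of record — joint selection, `D.sN`'s first argument is the literal handed to `D.sM`): SHORT pair `Mu D := D.sM D.M₀`, `nS D := D.sN D.M₀ (NegPrm.nS (D.n₁ (Mu D)) (Mu D) 0 (ρz D))` (zone floor `D.M₀` in BOTH selectors); `short_pair_eq` by rfl; `M₀_le_Mu/k_le_Mu/n₁_le_nS/Mu_lt_nS/ρz_le_nS` gain one `le_sM/le_sN` step.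
N1 HEADER (kept for the reader):
helper file (`--supports stmt-CriticalPhenomena-4575 --as helper`); ledger HOME/prim-bschramm-stmt/NEG-PARAMS.md v0.6.
ORDER (N.3 for N1, O-level part, every value a SEPARATE small definition so the unpacking files state facts by name): Step I″ hands `D` (`Λ, k, R, M₀, n₁ : ℕ → ℕ`,
`hgt/len/spl : V → ℕ → ℕ → _`; `StepI.exists_stepI_neg`, p3) → zone scale **`Mu := D.M₀`** (`Sz = {Mu}`), zone radius **`ρz := D.R Mu`** (no offset in N1) → short width
**`nS := NegPrm.nS (D.n₁ Mu) Mu 0 ρz = max (n₁ Mu) (Mu + 2 + ρz)`** (`R′`-free, v0.5 (n4)′) → short data **`(hS, ℓS, vS) := (D.hgt, D.len, D.spl) t Mu nS`** at the TYPE `t` → kit square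
**`As := NegPrm.As nS hS ℓS = D.scale t Mu nS`** (`As_eq_scale`, rfl), clamp `Mk`, `T₀ := tanOff Mk Mk`, depth `Kd`, `cU`, `Rseed`, `rs` (SkelNeg1ParamsKit at `R := D.R`) → Step-III sizes `sB, B` →
counts at `p`: `kP, NP, Lcnt` (`kitK/kitN/kitL` at `Neg.δkit`, verbatim D″) → levels `Rlev := T₀ + Lcnt`, **`R′ := Rlev + 1`** → long box
**`ML := NegPrm.ML Mu C′ c_max (4·K) R′ |hS| ℓS nS`** (floors `2C′(|h_s|+ℓ_s+n_s)`, `960 − 1`, `4K(R′+2)`, `Mu`) → long threshold `n₁L := D.n₁ ML`.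
* §1 the values; §2 the facts by name: `M₀_le_Mu`, `n₁_le_nS`, `Mu_lt_nS`, `ρz_le_nS`, `As_eq_scale`, `Mu_succ_le_As`, `one_le_R'`, `T₀_eq`, the `M_L` floors
  (`Mu_le_ML`, `hop_floor_le_ML`, `slack_floor_le_ML : 960 ≤ ML + 1`, `coarse_floor_le_ML : 4K(R′+2) ≤ ML`, `kit_floors_ML : 4K·R′+2 ≤ ML ∧ 4K+2 ≤ ML ∧ 8K+2 ≤ ML`), and the SHORT-pair
  unpacking of `D.EqGeom` (`eqGeomS_facts : Mu < nS ∧ Mu < ℓS ∧ |vS| ≤ nS ∧ (Mu+1)(nS+|hS|) ≤ nS(ℓS+1)`).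
[cite: KozmaNitzan2024, §4 Theorem 6 (pp. 25–31): the order of constants; Lemma 10 Steps II–III (pp. 18–19)] [cite: MartineauTassion2017, §3.2 Lemma 3.5, §3.3 Lemma 3.7]
-/

noncomputable section

open scoped Classical

namespace Summit.CriticalPhenomena.PercolationContinuityZ3.Theorems.Transplant

namespace PlanarSkeletonFrm

namespace Neg

open Literature.Probability.Percolation Literature.Probability.LatticeModels SimpleGraph
open SkelConc (Consts)
open BoxProdZ2 (kitK kitN kitL)
open SkelI (tanOff)

section Data

/-! ## §1 The values read off `D` alone -/

/-- **The zone scale** `M_u := D.M₀` (the list of zone sizes is `{M_u}`; `D.k ≤ M₀` is a Step-I″ fact). [this work] -/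
def Mu {V : Type} (D : Skelφ.StepI.DataNS V) : ℕ := D.sM D.M₀

/-- **The zone graph-radius** `ρz := D.R M_u` (the uniqueness zone at scale `M_u` lies in `graphBall c (R M_u)`; N1 has no seed offset). [this work] -/
def ρz {V : Type} (D : Skelφ.StepI.DataNS V) : ℕ := D.R (Mu D)

/-- **The short (kit-route) width** `n_s := max (n₁ M_u) (M_u + 2 + ρz)` (`NegPrm.nS` with the `R′` slot at `0`, NEG-PARAMS v0.5 (n4)′). [this work] -/
def nS {V : Type} (D : Skelφ.StepI.DataNS V) : ℕ := D.sN D.M₀ (Skelφ.NegPrm.nS (D.n₁ (Mu D)) (Mu D) 0 (ρz D))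

/-- The short shear `h_s := D.hgt t M_u n_s` (at the TYPE `t`). [this work] -/
def hS {V : Type} (t : V) (D : Skelφ.StepI.DataNS V) : ℤ := D.hgt t (Mu D) (nS D)

/-- The short half-length `ℓ_s := D.len t M_u n_s`. [this work] -/
def ℓS {V : Type} (t : V) (D : Skelφ.StepI.DataNS V) : ℕ := D.len t (Mu D) (nS D)

/-- The short split point `v_s := D.spl t M_u n_s`. [this work] -/
def vS {V : Type} (t : V) (D : Skelφ.StepI.DataNS V) : ℤ := D.spl t (Mu D) (nS D)

/-- **The kit square half-width** `As := pgScale n_s h_s (3ℓ_s)` (= `D.scale t M_u n_s`). [this work] -/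
def As {V : Type} (t : V) (D : Skelφ.StepI.DataNS V) : ℕ := Skelφ.NegPrm.As (nS D) (hS t D) (ℓS t D)

/-- **The clamp = seed-slab scale** `Mk := max (M_u + 1) As`. [this work] -/
def Mk {V : Type} (t : V) (D : Skelφ.StepI.DataNS V) : ℕ := Skelφ.NegPrm.Mk (Mu D) (nS D) (hS t D) (ℓS t D)

/-- The clamp offset `T₀ := tanOff Mk Mk = 3·Mk + 2`. [this work] -/
def T₀ {V : Type} (t : V) (D : Skelφ.StepI.DataNS V) : ℕ := tanOff (Mk t D) (Mk t D)

/-- The kit depth `Kd := Mk + 1 + Mk + max (R As) ρz`. [this work] -/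
def Kd {V : Type} (t : V) (D : Skelφ.StepI.DataNS V) : ℕ := Skelφ.NegPrm.Kd D.R (Mu D) (nS D) (hS t D) (ℓS t D) (ρz D)

/-- **The short pair IS the selected pair** at zone floor `D.M₀` and width floor `max (n₁ M_u) (M_u + 2 + ρz)` (by `rfl`; the closure reads colour and
admissibility of `(M_u, n_s)` off `col_selN/adm_selN` at these literals). [folklore] -/
theorem short_pair_eq {V : Type} (D : Skelφ.StepI.DataNS V) :
    Mu D = D.sM D.M₀ ∧ nS D = D.sN D.M₀ (Skelφ.NegPrm.nS (D.n₁ (Mu D)) (Mu D) 0 (ρz D)) := ⟨rfl, rfl⟩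

/-! ## §2a The facts read off `D` alone -/

/-- `D.M₀ ≤ M_u` (zone admissibility: `Prm.SzOf_adm`). [folklore] -/
theorem M₀_le_Mu {V : Type} (D : Skelφ.StepI.DataNS V) : D.M₀ ≤ Mu D := D.le_sM _

/-- `D.k ≤ M_u` from the Step-I″ fact `D.k ≤ D.M₀`. [folklore] -/
theorem k_le_Mu {V : Type} (D : Skelφ.StepI.DataNS V) (hk : D.k ≤ D.M₀) : D.k ≤ Mu D := hk.trans (D.le_sM _)

/-- `n₁ M_u ≤ n_s` (the short pair is admissible). [folklore] -/
theorem n₁_le_nS {V : Type} (D : Skelφ.StepI.DataNS V) : D.n₁ (Mu D) ≤ nS D := (Skelφ.NegPrm.n₁_le_nS _ _ _ _).trans (D.le_sN _ _)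

/-- `M_u < n_s` and `M_u + 2 + ρz ≤ n_s`. [folklore] -/
theorem Mu_lt_nS {V : Type} (D : Skelφ.StepI.DataNS V) : Mu D < nS D ∧ Mu D + 2 + ρz D ≤ nS D :=
  ⟨(Skelφ.NegPrm.Mu_lt_nS _ _ _ _).trans_le (D.le_sN _ _), by
    have := Skelφ.NegPrm.floor_le_nS (D.n₁ (Mu D)) (Mu D) 0 (ρz D)
    have h2 := D.le_sN D.M₀ (Skelφ.NegPrm.nS (D.n₁ (Mu D)) (Mu D) 0 (ρz D)); unfold nS; omega⟩

/-- `ρz ≤ n_s`. [folklore] -/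
theorem ρz_le_nS {V : Type} (D : Skelφ.StepI.DataNS V) : ρz D ≤ nS D := (Skelφ.NegPrm.R'_le_nS _ _ _ _).2.trans (D.le_sN _ _)

/-- **The kit square is Step I″'s link-region scale at the short pair**: `As = D.scale t M_u n_s`. [folklore] -/
theorem As_eq_scale {V : Type} (t : V) (D : Skelφ.StepI.DataNS V) : As t D = D.scale t (Mu D) (nS D) := rfl

/-- `As = pgScale n_s h_s (3ℓ_s)`. [folklore] -/
theorem As_eq {V : Type} (t : V) (D : Skelφ.StepI.DataNS V) : As t D = Skelφ.pgScale (nS D) (hS t D) (3 * ℓS t D) := rfl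

/-- `M_u + 1 ≤ As` and `n_s ≤ As`. [folklore] -/
theorem Mu_succ_le_As {V : Type} (t : V) (D : Skelφ.StepI.DataNS V) : Mu D + 1 ≤ As t D ∧ nS D ≤ As t D :=
  ⟨(Mu_lt_nS D).1 |> fun h => le_trans h (Skelφ.NegPrm.ns_le_As _ _ _), Skelφ.NegPrm.ns_le_As _ _ _⟩

/-- `Mk = As` (the clamp scale is the kit square). [folklore] -/
theorem Mk_eq_As {V : Type} (t : V) (D : Skelφ.StepI.DataNS V) : Mk t D = As t D := Skelφ.NegPrm.Mk_eq_As (Mu D) (nS D) (hS t D) (ℓS t D) (Mu_lt_nS D).1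

/-- `T₀ = 3·Mk + 2`. [folklore] -/
theorem T₀_eq {V : Type} (t : V) (D : Skelφ.StepI.DataNS V) : T₀ t D = 3 * Mk t D + 2 := Skelφ.NegPrm.tanOff_Mk _ _ _ _

end Data

section OLevel

/-! ## §1b The values that read the skeleton (degree bound, frames) and the density -/

/-- The face-count bound `cU := (Δ+1)^{R As}`. [this work] -/
def cU {V : Type} {G : SimpleGraph V} [G.LocallyFinite] (Φ : PlanarSkeletonFrm G) (t : V) (D : Skelφ.StepI.DataNS V) : ℕ := Skelφ.NegPrm.cU D.R (nS D) (hS t D) (ℓS t D) Φ.Δ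

/-- The seed-slab radius `Rseed` (frame-uniform comparison radii). [this work] -/
def Rseed {V : Type} {G : SimpleGraph V} [G.LocallyFinite] (Φ : PlanarSkeletonFrm G) (t : V) (D : Skelφ.StepI.DataNS V) : ℕ := Skelφ.NegPrm.Rseed D.R (Mu D) (nS D) (hS t D) (ℓS t D) G Φ.φ Φ.types

/-- The shell radius `rs` (also the near/far threshold of the kit). [this work] -/
def rs {V : Type} {G : SimpleGraph V} [G.LocallyFinite] (Φ : PlanarSkeletonFrm G) (t : V) (D : Skelφ.StepI.DataNS V) : ℕ := Skelφ.NegPrm.rs D.R (Mu D) (nS D) (hS t D) (ℓS t D) (ρz D) G Φ.φ Φ.types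

/-- The Step-III seed-size bound `sB := 1 + Δ((Δ+1)^{Rseed} + T₀ + 2) + ((Δ+1)^{Rseed} + T₀ + 2)·cU`. [this work] -/
def sB {V : Type} {G : SimpleGraph V} [G.LocallyFinite] (Φ : PlanarSkeletonFrm G) (t : V) (D : Skelφ.StepI.DataNS V) : ℕ := 1 + Φ.Δ * ((Φ.Δ + 1) ^ Rseed Φ t D + (T₀ t D + 2)) + ((Φ.Δ + 1) ^ Rseed Φ t D + (T₀ t D + 2)) * cU Φ t D

/-- The contact multiplier `B := (Δ+1)^{2 rs}`. [this work] -/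
def B {V : Type} {G : SimpleGraph V} [G.LocallyFinite] (Φ : PlanarSkeletonFrm G) (t : V) (D : Skelφ.StepI.DataNS V) : ℕ := (Φ.Δ + 1) ^ (2 * rs Φ t D)

/-- The number of seeds `k` at `(Δ, sB, B, δkit, p)`. [this work] -/
def kP (κ : Consts) {V : Type} [DecidableEq V] [Countable V] {G : SimpleGraph V} [G.LocallyFinite] (Φ : PlanarSkeletonFrm G) (t : V) (p : unitInterval) (D : Skelφ.StepI.DataNS V) : ℕ := kitK Φ.Δ (sB Φ t D) (B Φ t D) (Neg.δkit κ Φ) p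

/-- The number of contacts `N`. [this work] -/
def NP (κ : Consts) {V : Type} [DecidableEq V] [Countable V] {G : SimpleGraph V} [G.LocallyFinite] (Φ : PlanarSkeletonFrm G) (t : V) (p : unitInterval) (D : Skelφ.StepI.DataNS V) : ℕ := kitN Φ.Δ (sB Φ t D) (B Φ t D) (Neg.δkit κ Φ) p

/-- The number of levels `Lcnt`. [this work] -/
def Lcnt (κ : Consts) {V : Type} [DecidableEq V] [Countable V] {G : SimpleGraph V} [G.LocallyFinite] (Φ : PlanarSkeletonFrm G) (t : V) (p : unitInterval) (D : Skelφ.StepI.DataNS V) : ℕ := kitL Φ.Δ (sB Φ t D) (B Φ t D) (Neg.δkit κ Φ) p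

/-- The window depth in levels `Rlev := T₀ + Lcnt`. [this work] -/
def Rlev (κ : Consts) {V : Type} [DecidableEq V] [Countable V] {G : SimpleGraph V} [G.LocallyFinite] (Φ : PlanarSkeletonFrm G) (t : V) (p : unitInterval) (D : Skelφ.StepI.DataNS V) : ℕ := T₀ t D + Lcnt κ Φ t p D

/-- **The band growth / kit-level displacement** `R′ := Rlev + 1` (φ-rows; in run units `R′ + 1`, p1's `SkelPhiParaRunDisp`). [this work] -/
def R' (κ : Consts) {V : Type} [DecidableEq V] [Countable V] {G : SimpleGraph V} [G.LocallyFinite] (Φ : PlanarSkeletonFrm G) (t : V) (p : unitInterval) (D : Skelφ.StepI.DataNS V) : ℕ := Rlev κ Φ t p D + 1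

/-- **The long BOX** `M_L := ML M_u C′ c_max (4K) R′ |h_s| ℓ_s n_s` (chosen AFTER the short data and the kit levels; every floor lives here). [this work] -/
def ML (κ : Consts) {V : Type} [DecidableEq V] [Countable V] {G : SimpleGraph V} [G.LocallyFinite] (Φ : PlanarSkeletonFrm G) (t : V) (p : unitInterval) (D : Skelφ.StepI.DataNS V) : ℕ := Skelφ.NegPrm.ML (Mu D) Neg.C' Neg.cmax (4 * Neg.K κ) (R' κ Φ t p D) (hS t D).natAbs (ℓS t D) (nS D)

/-- The long width threshold `n₁ M_L` (the long width `n_L ≥ max (n₁ M_L) (M_L + 1) …` is fixed in part 3b with the (R) clearance slot). [this work] -/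
def n₁L (κ : Consts) {V : Type} [DecidableEq V] [Countable V] {G : SimpleGraph V} [G.LocallyFinite] (Φ : PlanarSkeletonFrm G) (t : V) (p : unitInterval) (D : Skelφ.StepI.DataNS V) : ℕ := D.n₁ (ML κ Φ t p D)

/-! ## §2b The facts that read the counts -/

/-- `n_s < T₀ < R′`: the kit levels sit above the short scale (v0.5 (n11)). [folklore] -/
theorem nS_lt_R' (κ : Consts) {V : Type} [DecidableEq V] [Countable V] {G : SimpleGraph V} [G.LocallyFinite] (Φ : PlanarSkeletonFrm G) (t : V) (p : unitInterval) (D : Skelφ.StepI.DataNS V) : nS D < T₀ t D ∧ T₀ t D < R' κ Φ t p D := by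
  refine ⟨Skelφ.NegPrm.ns_lt_tanOff _ _ _ _, ?_⟩
  unfold R' Rlev; omega

/-- `1 ≤ R′` and `T₀ + 1 ≤ R′`. [folklore] -/
theorem one_le_R' (κ : Consts) {V : Type} [DecidableEq V] [Countable V] {G : SimpleGraph V} [G.LocallyFinite] (Φ : PlanarSkeletonFrm G) (t : V) (p : unitInterval) (D : Skelφ.StepI.DataNS V) : 1 ≤ R' κ Φ t p D ∧ T₀ t D + 1 ≤ R' κ Φ t p D := by unfold R' Rlev; omega

/-- `M_u ≤ M_L`. [folklore] -/
theorem Mu_le_ML (κ : Consts) {V : Type} [DecidableEq V] [Countable V] {G : SimpleGraph V} [G.LocallyFinite] (Φ : PlanarSkeletonFrm G) (t : V) (p : unitInterval) (D : Skelφ.StepI.DataNS V) : Mu D ≤ ML κ Φ t p D := Skelφ.NegPrm.Mu_le_ML _ _ _ _ _ _ _ _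

/-- D4's floor `2C′(|h_s| + ℓ_s + n_s) ≤ M_L` with `C′ = 8`. [folklore] -/
theorem hop_floor_le_ML (κ : Consts) {V : Type} [DecidableEq V] [Countable V] {G : SimpleGraph V} [G.LocallyFinite] (Φ : PlanarSkeletonFrm G) (t : V) (p : unitInterval) (D : Skelφ.StepI.DataNS V) : 2 * Neg.C' * ((hS t D).natAbs + ℓS t D + nS D) ≤ ML κ Φ t p D := Skelφ.NegPrm.hop_floor_le_ML _ _ _ _ _ _ _ _

/-- The y′-layer slack floor `960 ≤ M_L + 1` (`320·c_max`, `c_max = 3`). [folklore] -/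
theorem slack_floor_le_ML (κ : Consts) {V : Type} [DecidableEq V] [Countable V] {G : SimpleGraph V} [G.LocallyFinite] (Φ : PlanarSkeletonFrm G) (t : V) (p : unitInterval) (D : Skelφ.StepI.DataNS V) : 960 ≤ ML κ Φ t p D + 1 := by
  have h := Skelφ.NegPrm.slack_floor_le_ML (Mu D) Neg.C' Neg.cmax (4 * Neg.K κ) (R' κ Φ t p D) (hS t D).natAbs (ℓS t D) (nS D)
  rw [Neg.cmax_eq.2] at h
  exact h

/-- The coarse floor `4K(R′+2) ≤ M_L` (and `4K ≤ M_L`). [folklore] -/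
theorem coarse_floor_le_ML (κ : Consts) {V : Type} [DecidableEq V] [Countable V] {G : SimpleGraph V} [G.LocallyFinite] (Φ : PlanarSkeletonFrm G) (t : V) (p : unitInterval) (D : Skelφ.StepI.DataNS V) : 4 * Neg.K κ * (R' κ Φ t p D + 2) ≤ ML κ Φ t p D ∧ 4 * Neg.K κ ≤ ML κ Φ t p D :=
  Skelφ.NegPrm.coarse_floor_le_ML _ _ _ _ _ _ _ _

/-- **The kit-drift / ρ-Lipschitz / representative floors**: `4K·R′ + 2 ≤ M_L`, `4K + 2 ≤ M_L`, `8K + 2 ≤ M_L` (the hypotheses of `coarse_drift_le_one`, `lip_coarse`,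
`exists_coarse_eq` at `M := M_L`). [folklore] -/
theorem kit_floors_ML (κ : Consts) {V : Type} [DecidableEq V] [Countable V] {G : SimpleGraph V} [G.LocallyFinite] (Φ : PlanarSkeletonFrm G) (t : V) (p : unitInterval) (D : Skelφ.StepI.DataNS V) : 4 * Neg.K κ * R' κ Φ t p D + 2 ≤ ML κ Φ t p D ∧ 4 * Neg.K κ + 2 ≤ ML κ Φ t p D ∧ 8 * Neg.K κ + 2 ≤ ML κ Φ t p D := by
  obtain ⟨h1, h2, -, -⟩ := Skelφ.NegPrm.kit_floor_of_ML (Neg.forty_le_K κ).2.2 (Mu D) Neg.C' Neg.cmax (R' κ Φ t p D) (hS t D).natAbs (ℓS t D) (nS D)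
  have h3 := (coarse_floor_le_ML κ Φ t p D).1
  have hR := (one_le_R' κ Φ t p D).1
  have hK := (Neg.forty_le_K κ).2.2
  refine ⟨h1, h2, ?_⟩
  have e : 4 * Neg.K κ * (R' κ Φ t p D + 2) = 4 * Neg.K κ * R' κ Φ t p D + 8 * Neg.K κ := by ring
  rw [e] at h3
  nlinarith

/-- `n_s < M_L + 1` hence the long scale will dominate the short one (`2C′ n_s ≤ M_L`, `C′ = 8`). [folklore] -/
theorem nS_le_ML (κ : Consts) {V : Type} [DecidableEq V] [Countable V] {G : SimpleGraph V} [G.LocallyFinite] (Φ : PlanarSkeletonFrm G) (t : V) (p : unitInterval) (D : Skelφ.StepI.DataNS V) : nS D ≤ ML κ Φ t p D := by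
  have h := hop_floor_le_ML κ Φ t p D
  rw [Neg.C'_eq.1] at h
  omega

/-- **The short pair's geometric clause unpacked** (from `D.EqGeom G Φ.φ t M_u n_s`, a Step-I″ output at every admissible pair): `M_u < n_s`, `M_u < ℓ_s`, `|v_s| ≤ n_s`,
`(M_u+1)(n_s+|h_s|) ≤ n_s(ℓ_s+1)` — in the `ℤ` shapes `SkelNegParamsCoarse/Lattice` consume. [folklore] -/
theorem eqGeomS_facts {V : Type} {G : SimpleGraph V} [G.LocallyFinite] (Φ : PlanarSkeletonFrm G) (t : V) (D : Skelφ.StepI.DataNS V) (hE : D.EqGeom G Φ.φ t (Mu D) (nS D)) :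
    Mu D < nS D ∧ Mu D < ℓS t D ∧ |vS t D| ≤ (nS D : ℤ) ∧ ((Mu D : ℤ) + 1) * ((nS D : ℤ) + |hS t D|) ≤ (nS D : ℤ) * ((ℓS t D : ℤ) + 1) := by
  obtain ⟨h1, h2, h3, h4, -⟩ := hE
  refine ⟨h1, h2, h3, ?_⟩
  have e1 : (((nS D) + (D.hgt t (Mu D) (nS D)).natAbs : ℕ) : ℤ) = (nS D : ℤ) + |hS t D| := by push_cast; rfl
  have e2 : (((D.len t (Mu D) (nS D)) + 1 : ℕ) : ℤ) = (ℓS t D : ℤ) + 1 := by push_cast; rfl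
  rw [e1, e2] at h4
  exact h4

end OLevel

end Neg

end PlanarSkeletonFrm

end Summit.CriticalPhenomena.PercolationContinuityZ3.Theorems.Transplant

end
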